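import Literature.AlgebraicGeometry.Resolution.ZariskiPatchingAllDimensions
import Literature.AlgebraicGeometry.Resolution.ProperModels
import Mathlib.RingTheory.EssentialFiniteness
import HarnessLib

/-!
# Zariski's patching programme in every dimension with PROPER models: resolution from relative
# local uniformization and the patching of two proper models

Topic: `Literature/AlgebraicGeometry/Resolution`. `ZariskiPatchingAllDimensions.lean` records the
dimension-free form of Zariski's patching programme (Zariski 1944, Fundamental Theorem p. 539;
Piltant 2013, Prop. 5.1 with `P = P_reg` and Cor. 5.7) with PROJECTIVE models: relative local
uniformization + two-model patching of projective models ⇒ resolution. Piltant's own output in the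
proof of Prop. 5.1 (Step 5: "glue along … to a proper model `Y/k` of `K`") is a PROPER model, and
Zariski's compactness / finite-resolving-system argument never uses projectivity of the models it
patches. This file records the same three theorems with the two-model patching hypothesis stated
for proper models (`ProperModel`, `ProperModels.lean`); the proofs are those of
`ZariskiPatchingAllDimensions.lean`, with the finite resolving system of projective closures of
affine models pushed to proper models (`ProjModel.toProperModel`,
`ProjModel.toProperModel_regCentre_iff`) and patched by
`ProperModel.hasResolution_of_resolvingSystem_of_regLe`.

* `hasResolution_of_properPatching_of_relLU` — for an integral closed subscheme `X ⊆ ℙⁿ_k` (any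
  dimension): two-model patching of proper models for all function fields over `k` + relative LU
  over `k` ⇒ `Scheme.HasResolution X`.
* `resolutionOverUpToDim_of_properPatching_of_relLU` — hence weak resolution of every reduced
  separated `k`-scheme of finite type (components + Chow + projective closure,
  `ResolutionOverUpToDim.of_projective`), in every dimension.
* `resolutionInChar_of_properTwoModelPatching_of_relLU` — hence, in characteristic `p`:
  two-model patching of proper models over all fields of characteristic `p` + relative LU in
  characteristic `p` (the shape `LUrel_p`) ⇒ `ResolutionInChar.{0} p`.

## References

* O. Zariski, *Reduction of the singularities of algebraic three dimensional varieties*, Ann.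
  of Math. 45 (1944) 472–542, Fundamental Theorem p. 539.
* O. Zariski, P. Samuel, *Commutative Algebra* II, Ch. VI §17. [ZariskiSamuel1960]
* O. Piltant, *An axiomatic version of Zariski's patching theorem*, RACSAM 107 (2013) 91–121,
  p. 2, Prop. 5.1 (proof, Step 5), Cor. 5.7. [Piltant2013]
-/

noncomputable section

open CategoryTheory AlgebraicGeometry TopologicalSpace IsLocalRing

namespace Literature.AlgebraicGeometry.Resolution

universe u

/-- **Resolution of an integral projective variety of ANY dimension from relative local
uniformization and the patching of two PROPER models** (Zariski 1944; Piltant 2013, Prop. 5.1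
and Cor. 5.7, with proper in place of projective models): for an integral closed subscheme
`X ⊆ ℙⁿ_k`, relative LU over `k` and two-model patching of proper models for function fields over
`k` give `Scheme.HasResolution X`. Proof verbatim that of
`hasResolution_of_twoModelPatching_of_relLU`, except that the finite resolving system of
projective models is pushed to proper models (`ProjModel.toProperModel`) and patched by
`ProperModel.hasResolution_of_resolvingSystem_of_regLe`. [cite: Piltant2013, Prop. 5.1 and Cor. 5.7] -/
theorem hasResolution_of_properPatching_of_relLU {k : Type u} [Field k]
    (hZ : ∀ (K : Type u) [Field K] [Algebra k K] [Algebra.EssFiniteType k K],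
      ∀ M₁ M₂ : ProperModel k K,
        ∃ (N : ProperModel k K) (φ₁ : N.Hom M₁) (φ₂ : N.Hom M₂), φ₁.RegLe ∧ φ₂.RegLe)
    (hLU : ∀ (K : Type u) [Field K] [Algebra k K] (O : ValuationSubring K) (R : Subalgebra k K),
      R.FG → IsFractionRing R K → R.toSubring ≤ O.toSubring →
        ∃ (A : Subalgebra k K) (h : A.toSubring ≤ O.toSubring), R ≤ A ∧ A.FG ∧
          IsRegularLocalRing (Localization.AtPrime
            (Ideal.comap (Subring.inclusion h) (IsLocalRing.maximalIdeal O))))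
    {n : ℕ} (X : Scheme.{u}) [IsIntegral X]
    (ι : X ⟶ (Motives.projectiveSpace n k).left) [IsClosedImmersion ι] :
    Scheme.HasResolution X := by
  classical
  haveI : IsProper (Motives.projectiveSpace n k).hom := Motives.isProper_projectiveSpace n k
  let πX : X ⟶ Spec (.of k) := ι ≫ (Motives.projectiveSpace n k).hom
  have hproj : Motives.IsProjectiveOver (Over.mk πX) := ⟨n, Over.homMk ι rfl, ‹_›⟩
  haveI : LocallyOfFiniteType πX := inferInstance
  -- an affine chart `U = Spec A` of `X`
  obtain ⟨_, ⟨U', hU', rfl⟩, hηU, -⟩ := X.isBasis_affineOpens.exists_subset_of_mem_open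
    (Set.mem_univ (genericPoint X)) isOpen_univ
  let U : X.Opens := U'
  have hU : IsAffineOpen U := hU'
  haveI : IsAffine U := hU
  haveI : Nonempty U := ⟨⟨_, hηU⟩⟩
  let A : Type u := Γ(U, ⊤)
  -- `A` is a finitely generated `k`-algebra
  let g : (U : Scheme.{u}) ⟶ Spec (.of k) := U.ι ≫ πX
  let ψ : k →+* A := g.appTop.hom.comp (Scheme.ΓSpecIso (.of k)).inv.hom
  have hψ : ψ.FiniteType := by
    have h1 : g.appTop.hom.FiniteType :=
      (HasRingHomProperty.iff_of_isAffine (P := @LocallyOfFiniteType)).mp inferInstance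
    exact h1.comp (RingHom.FiniteType.of_surjective _
      (Scheme.ΓSpecIso (.of k)).symm.commRingCatIsoToRingEquiv.surjective)
  letI : Algebra k A := ψ.toAlgebra
  haveI hft : Algebra.FiniteType k A := hψ
  -- its fraction field `K`, and `X` as a projective model of `K/k`
  let K : Type u := FractionRing A
  let j : Spec (.of A) ⟶ X := U.toScheme.isoSpec.inv ≫ U.ι
  have hj : j ≫ πX = Spec.map (CommRingCat.ofHom (algebraMap k A)) := by
    change (U.toScheme.isoSpec.inv ≫ U.ι) ≫ πX = Spec.map (CommRingCat.ofHom ψ)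
    rw [Category.assoc, isoSpec_inv_comp]
    rfl
  let M₀ : ProjModel k K := ProjModel.ofChart (K := K) X πX hproj A j hj
  -- `A` as a subalgebra `A₀ ⊆ K`, finitely generated with `Frac A₀ = K`
  let toK : A →ₐ[k] K := IsScalarTower.toAlgHom k A K
  have htoK : Function.Injective toK := IsFractionRing.injective A K
  let A₀ : Subalgebra k K := toK.range
  have hA₀fg : A₀.FG := by
    rw [show A₀ = Subalgebra.map toK ⊤ from (Algebra.map_top toK).symm]
    exact Subalgebra.FG.map toK hft.out
  haveI hA₀fr : IsFractionRing A₀ K := by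
    refine IsFractionRing.of_field A₀ K fun z => ?_
    obtain ⟨a, b, -, rfl⟩ := IsFractionRing.div_surjective (A := A) z
    exact ⟨⟨algebraMap A K a, a, rfl⟩, ⟨algebraMap A K b, b, rfl⟩, rfl⟩
  -- a finite resolving system of affine models, from (LU)
  have hcov : ∀ v : ZariskiRiemannSpace k K, ∃ T : Subalgebra k K,
      (T.FG ∧ IsFractionRing T K) ∧ ZariskiRiemannSpace.HasRegularCentre T v :=
    fun v => exists_hasRegularCentre_of_relLU (hLU K) A₀ hA₀fg v
  obtain ⟨𝒯, h𝒯, h𝒯cov⟩ := exists_finite_resolvingSystem' (P := fun T => IsFractionRing T K)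
    (fun T hT => (isJ2Ring_of_field k).2 T ((Subalgebra.fg_iff_finiteType T).mp hT)) hcov
  -- their projective closures, as PROPER models: a finite resolving system of proper models
  have hM : ∀ T : ↥𝒯, ∃ M : ProperModel k K, ∀ w : ZariskiRiemannSpace k K,
      ZariskiRiemannSpace.HasRegularCentre T.1 w → M.RegCentre w := fun T => by
    haveI := (h𝒯 T.1 T.2).2
    obtain ⟨M, hM⟩ := ProjModel.exists_regCentre_of_hasRegularCentre T.1 (h𝒯 T.1 T.2).1
    exact ⟨M.toProperModel, fun w hw => (M.toProperModel_regCentre_iff w).mpr (hM w hw)⟩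
  choose M hM using hM
  let l : List (ProperModel k K) := 𝒯.attach.toList.map M
  have hlcov : ∀ v : ZariskiRiemannSpace k K, ∃ N ∈ l, N.RegCentre v := by
    intro v
    obtain ⟨T, hT, hTv⟩ := h𝒯cov v
    refine ⟨M ⟨T, hT⟩, ?_, hM ⟨T, hT⟩ v hTv⟩
    exact List.mem_map.mpr ⟨⟨T, hT⟩, Finset.mem_toList.mpr (Finset.mem_attach _ _), rfl⟩
  -- patch
  haveI : Algebra.EssFiniteType k K := inferInstance
  exact ProperModel.hasResolution_of_resolvingSystem_of_regLe (hZ K) M₀.toProperModel l hlcov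

/-- **Weak resolution in every dimension over `k` from relative LU over `k` and two-model
patching of PROPER models over `k`** (reduction to the integral projective case by
`ResolutionOverUpToDim.of_projective`: components, Chow's lemma, projective closure).
[cite: Piltant2013, Prop. 5.1 and Cor. 5.7] -/
theorem resolutionOverUpToDim_of_properPatching_of_relLU {k : Type u} [Field k]
    (hZ : ∀ (K : Type u) [Field K] [Algebra k K] [Algebra.EssFiniteType k K],
      ∀ M₁ M₂ : ProperModel k K,
        ∃ (N : ProperModel k K) (φ₁ : N.Hom M₁) (φ₂ : N.Hom M₂), φ₁.RegLe ∧ φ₂.RegLe)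
    (hLU : ∀ (K : Type u) [Field K] [Algebra k K] (O : ValuationSubring K) (R : Subalgebra k K),
      R.FG → IsFractionRing R K → R.toSubring ≤ O.toSubring →
        ∃ (A : Subalgebra k K) (h : A.toSubring ≤ O.toSubring), R ≤ A ∧ A.FG ∧
          IsRegularLocalRing (Localization.AtPrime
            (Ideal.comap (Subring.inclusion h) (IsLocalRing.maximalIdeal O))))
    (d : ℕ) : ResolutionOverUpToDim k d :=
  ResolutionOverUpToDim.of_projective fun _ X ι hι hint _ => by
    haveI := hι
    haveI := hint
    exact hasResolution_of_properPatching_of_relLU hZ hLU X ι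

/-- **Resolution in characteristic `p` from relative LU in characteristic `p` and two-model
patching of PROPER models over fields of characteristic `p`** — the proper twin of
`resolutionInChar_of_twoModelPatching_of_relLU`: the dimension-free content of Zariski's
programme needs only proper models (Piltant 2013, Prop. 5.1 for `P = P_reg`, whose output in
Step 5 of the proof is a proper model; open in dimension `≥ 4`, p. 2). The LU hypothesis is taken
in the shape of `LUrel_p` (finitely generated `K/k`, `k ⊆ O`, arbitrary finitely generated
`R ⊆ O`). [cite: Piltant2013, p. 2 and Prop. 5.1] -/
theorem resolutionInChar_of_properTwoModelPatching_of_relLU {p : ℕ}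
    (hZ : ∀ (k : Type) [Field k] [CharP k p] (K : Type) [Field K] [Algebra k K]
      [Algebra.EssFiniteType k K], ∀ M₁ M₂ : ProperModel k K,
        ∃ (N : ProperModel k K) (φ₁ : N.Hom M₁) (φ₂ : N.Hom M₂), φ₁.RegLe ∧ φ₂.RegLe)
    (hLU : ∀ (k K : Type) [Field k] [CharP k p] [Field K] [Algebra k K],
      (⊤ : IntermediateField k K).FG → ∀ O : ValuationSubring K,
        (∀ c : k, algebraMap k K c ∈ O) → ∀ R : Subalgebra k K, R.FG →
          R.toSubring ≤ O.toSubring →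
            ∃ (A : Subalgebra k K) (h : A.toSubring ≤ O.toSubring), R ≤ A ∧ A.FG ∧
              IsFractionRing A K ∧ IsRegularLocalRing (Localization.AtPrime
                (Ideal.comap (Subring.inclusion h) (IsLocalRing.maximalIdeal O)))) :
    ResolutionInChar.{0} p := by
  intro k _ _ X f hs hl hq hr
  haveI : QuasiCompact f := hq
  haveI : LocallyOfFiniteType f := hl
  haveI : CompactSpace X := QuasiCompact.compactSpace_of_compactSpace f
  obtain ⟨d, hd⟩ := exists_topologicalKrullDim_le_of_locallyOfFiniteType f
  have hLU' : ∀ (K : Type) [Field K] [Algebra k K] (O : ValuationSubring K) (R : Subalgebra k K),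
      R.FG → IsFractionRing R K → R.toSubring ≤ O.toSubring →
        ∃ (A : Subalgebra k K) (h : A.toSubring ≤ O.toSubring), R ≤ A ∧ A.FG ∧
          IsRegularLocalRing (Localization.AtPrime
            (Ideal.comap (Subring.inclusion h) (IsLocalRing.maximalIdeal O))) := by
    intro K _ _ O R hRfg hRfr hRO
    haveI : Algebra.FiniteType k R := R.fg_iff_finiteType.mp hRfg
    haveI : Algebra.EssFiniteType R K :=
      Algebra.EssFiniteType.of_isLocalization K (nonZeroDivisors R)
    have hKfg : (⊤ : IntermediateField k K).FG :=
      IntermediateField.fg_top_iff.mpr (Algebra.EssFiniteType.comp k R K)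
    obtain ⟨A, h, hle, hAfg, -, hreg⟩ :=
      hLU k K hKfg O (fun c => hRO (R.algebraMap_mem c)) R hRfg hRO
    exact ⟨A, h, hle, hAfg, hreg⟩
  exact resolutionOverUpToDim_of_properPatching_of_relLU (hZ k) hLU' d X f hs hl hq hr hd

end Literature.AlgebraicGeometry.Resolution

end
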